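import Literature.Probability.Percolation.OneArmPivotalSum
import Literature.Probability.Percolation.OneArmQuasiMultNearCritical
import Literature.Probability.Percolation.NearCriticalFourArmFactsSymm
import Literature.Probability.Percolation.WernerCorrelationLengthProofs
import HarnessLib

/-!
# The one-arm pivotal sum in the bulk, on both sides of `1/2` (proofs only)

Topic `Literature/Probability/Percolation`; family `crit-perc`, statement **crit-perc.S16**
(`Literature.Probability.Percolation.triTheta_exponent`). Proofs only (no new definition, no new
named fact). Sibling of `OneArmPivotalSum.lean`, which proves the bulk part of Werner's differential
inequality for the one-arm event (W. Werner, PCMI 2009, Lecture 6, §5: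
`Σ_x P_p(x pivotal for 0 ↔ ∂Λ_n) ≤ c n² π̂_p(n) P_p(0 ↔ ∂Λ_n)`; P. Nolin, *Electron. J. Probab.* 13
(2008), §6.2, proof of Thm. 27, Case 1 [arXiv 0711.4948: Thm. 26]) for `t ∈ [1/2, 1/2 + δ)`. Here
the same bound is proved for `t` on BOTH sides of `1/2`, as needed for the sub-critical half of
Nolin's Thm. 27 for one arm (`oneArm_sub_of_pivotal_bound_div`, `NearCriticalScalingOneArmProofs.lean`;
Nolin's statement is "uniformly in `P̂` between `P_p` and `P_{1-p}`"). Two inputs change on the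
sub-critical side `t < 1/2`, where the open colour is sub-critical:

* the quasi-multiplicativity and extendability of the open arm hold only below the characteristic
  length: `triOneArm_quasiMult_nearCritical`, `triOneArm_extend_nearCritical`
  (`OneArmQuasiMultNearCritical.lean`, scales `a` with `2a ≤ L_ε(t)`, resp. `4a ≤ L_ε(t)`), whence
  the restriction `4N ≤ L_ε(t)` below (all scales used are `≤ N`);
* the four-arm facts `Werner2009_fourArm_quasiMult`, `Werner2009_fourArm_lowerBound` are used in
  their two-sided forms (`NearCriticalFourArmFactsSymm.lean`, colour exchange), at radii
  `≤ N ≤ L_ε(t) ≤ L(t, ε)` (`charLength_le_charLengthW`);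

and the crude bound for the sites closest to the origin becomes `P_t(v pivotal) ≤ P_t(A)/t ≤ 4 P_t(A)`
for `t ≥ 1/4`. The per-site regimes of `OneArmPivotalSum.lean` (`pivotal_bound_inner/mid/small`,
`inner_outer_le`, `extend_twice_le`) are re-proved verbatim with the quasi-multiplicativity
hypotheses restricted to scales `a ≤ N` (`…'` versions), and summed as there.

Main result: `oneArmPivotalSum_bulk_le_twoSided`.

## References

* W. Werner, *Lectures on two-dimensional critical percolation*, IAS/Park City Math. Ser. 16
  (2009), Lecture 6, §3, Cor. 6.2, proof of Lemma 6.2 and §5 [WernerPCMI2009].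
* P. Nolin, Near-critical percolation in two dimensions, *Electron. J. Probab.* 13 (2008), §6.2,
  proof of Thm. 27, Case 1, eqs. (6.6)–(6.9) [arXiv 0711.4948: Thm. 26] [Nolin2008].
* H. Kesten, Scaling relations for 2D-percolation, *Comm. Math. Phys.* 109 (1987), Lemma 8
  [KestenScalingCMP1987].

Tree: `measureReal_isPivotal_triOneArm_le` (`OneArmPivotalBound.lean`), `fourArmProbAt_le_ratio_mul`,
`measureReal_isPivotal_le_div`, `card_triSphere_le`, `sum_triBall_eq_sum_triSphere`,
`sum_shell_weight_le`, `div_rpow_two_sub` (`OneArmPivotalSum.lean`), `armEvent_one_subset_triAnnulusCrossing`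
(`ArmEventsAPriori.lean`), `Werner2009_fourArm_quasiMult.two_sided`,
`Werner2009_fourArm_lowerBound.two_sided` (`NearCriticalFourArmFactsSymm.lean`),
`triOneArm_quasiMult_nearCritical`, `triOneArm_extend_nearCritical`
(`OneArmQuasiMultNearCritical.lean`), `charLength_le_charLengthW` (`WernerCorrelationLengthProofs.lean`).
-/

noncomputable section

open MeasureTheory Set Finset Real
open scoped unitInterval

namespace Literature.Probability.Percolation

open LatticeModels

/-! ### Inner and outer arm glued, with quasi-multiplicativity at scales `≤ N` only -/

/-- **Gluing the inner and the outer arm** (Nolin 2008, §6.2, (6.6)), the tree's `inner_outer_le`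
with the quasi-multiplicativity and extendability hypotheses restricted to scales `a ≤ N` (as
available on the sub-critical side below `L_ε`): for `|v| = k ≥ 3430`, `d = ⌊k/8⌋`, `m = k - d - 1`,
`m' = k + d + 1`, `k + 1 ≤ 0.32 N`, `N ≥ 8000`,
`P_t(0 ↔ ∂Λ_m) · P_t(armEvent ![T] m' N) ≤ (1/(c c')) P_t(0 ↔ ∂Λ_N)`. [cite: Nolin2008, §6.2, proof of Thm. 27, Case 1, eq. (6.6) (arXiv 0711.4948: Thm. 26)] -/
theorem inner_outer_le' {t : unitInterval} {c c' : ℝ} (hc : 0 < c) (hc' : 0 < c') {N : ℕ}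
    (hq : ∀ a : ℕ, 1000 ≤ a → a ≤ N → ∀ m : ℕ, 3 * a ≤ m → ∀ R : ℝ, 8 * (a : ℝ) ≤ R →
      ∀ n : ℕ, (n : ℝ) ≤ R →
        c * ((triSitePercolation t).real (triOneArm m) *
          (triSitePercolation t).real (triOpenCrossing (4 * a) R)) ≤
          (triSitePercolation t).real (triOneArm n))
    (hext : ∀ a : ℕ, 1000 ≤ a → a ≤ N → ∀ m n : ℕ, 3 * a ≤ m → n ≤ 8 * a →
      c' * (triSitePercolation t).real (triOneArm m) ≤ (triSitePercolation t).real (triOneArm n))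
    {k d m m' : ℕ} (hN : 8000 ≤ N) (hk : 3430 ≤ k) (hkN : k + 1 ≤ 32 * N / 100) (hd : d = k / 8)
    (hm : m + d + 1 = k) (hm' : m' = k + d + 1) :
    (triSitePercolation t).real (triOneArm m) *
        (triSitePercolation t).real (armEvent ![true] m' N) ≤
      1 / (c * c') * (triSitePercolation t).real (triOneArm N) := by
  set a : ℕ := m / 3 with ha
  set n86 : ℕ := 86 * N / 100 with hn86
  have ha1000 : 1000 ≤ a := by omega
  have haN : a ≤ N := by omega
  have h3a : 3 * a ≤ m := by omega
  have h8a : 8 * a ≤ n86 := by omega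
  have h4a : m' + 1 ≤ 4 * a := by omega
  have hN1 : 1 ≤ N := by omega
  -- the outer arm crosses the Euclidean annulus `A(4a, n86)`
  have hsub : armEvent ![true] m' N ⊆ triOpenCrossing (4 * (a : ℝ)) (n86 : ℝ) := by
    refine (armEvent_one_subset_triAnnulusCrossing true hN1).trans (triAnnulusCrossing_mono ?_ ?_)
    · exact_mod_cast h4a
    · rw [hn86]
      have h1 : ((86 * N / 100 : ℕ) : ℝ) ≤ ((86 * N : ℕ) : ℝ) / 100 := Nat.cast_div_le
      have h2 : ((86 * N : ℕ) : ℝ) / 100 = 86 / 100 * (N : ℝ) := by push_cast; ring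
      linarith
  have h1 := hq a ha1000 haN m h3a (n86 : ℝ) (by exact_mod_cast h8a) n86 le_rfl
  -- extend from `n86` to `N`
  set a₂ : ℕ := N / 8 + 1 with ha₂
  have h2 := hext a₂ (by omega) (by omega) n86 N (by omega) (by omega)
  have hX : (triSitePercolation t).real (armEvent ![true] m' N) ≤
      (triSitePercolation t).real (triOpenCrossing (4 * (a : ℝ)) (n86 : ℝ)) := measureReal_mono hsub
  have hAm : 0 ≤ (triSitePercolation t).real (triOneArm m) := measureReal_nonneg
  calc (triSitePercolation t).real (triOneArm m) * (triSitePercolation t).real (armEvent ![true] m' N)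
      ≤ (triSitePercolation t).real (triOneArm m) *
          (triSitePercolation t).real (triOpenCrossing (4 * (a : ℝ)) (n86 : ℝ)) :=
        mul_le_mul_of_nonneg_left hX hAm
    _ ≤ (1 / c) * (triSitePercolation t).real (triOneArm n86) := by
        rw [one_div, ← div_eq_inv_mul, le_div_iff₀' hc]
        exact h1
    _ ≤ (1 / c) * ((1 / c') * (triSitePercolation t).real (triOneArm N)) := by
        refine mul_le_mul_of_nonneg_left ?_ (by positivity)
        rw [one_div, ← div_eq_inv_mul, le_div_iff₀' hc']
        exact h2
    _ = 1 / (c * c') * (triSitePercolation t).real (triOneArm N) := by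
        field_simp

/-- **Two extensions** (the tree's `extend_twice_le` with extendability at scales `a ≤ N` only):
`P_t(0 ↔ ∂Λ_m) ≤ (1/c'²) P_t(0 ↔ ∂Λ_N)` for `0.27 N - 3 ≤ m ≤ N`, `N ≥ 12000`. [cite: Nolin2008, §4.5, Prop. 16 (arXiv 0711.4948: Prop. 15), j = 1] -/
theorem extend_twice_le' {t : unitInterval} {c' : ℝ} (hc' : 0 < c') {N : ℕ}
    (hext : ∀ a : ℕ, 1000 ≤ a → a ≤ N → ∀ m n : ℕ, 3 * a ≤ m → n ≤ 8 * a →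
      c' * (triSitePercolation t).real (triOneArm m) ≤ (triSitePercolation t).real (triOneArm n))
    {m : ℕ} (hN : 12000 ≤ N) (hm : 27 * N ≤ 100 * m + 300) (hmN : m ≤ N) :
    (triSitePercolation t).real (triOneArm m) ≤
      1 / c' ^ 2 * (triSitePercolation t).real (triOneArm N) := by
  set a₃ : ℕ := m / 3 with ha₃
  set a₄ : ℕ := 8 * a₃ / 3 with ha₄
  have h1 := hext a₃ (by omega) (by omega) m (8 * a₃) (by omega) le_rfl
  have h2 := hext a₄ (by omega) (by omega) (8 * a₃) N (by omega) (by omega)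
  have hpos : 0 < c' ^ 2 := by positivity
  rw [one_div, ← div_eq_inv_mul, le_div_iff₀' hpos]
  calc c' ^ 2 * (triSitePercolation t).real (triOneArm m)
      = c' * (c' * (triSitePercolation t).real (triOneArm m)) := by ring
    _ ≤ c' * (triSitePercolation t).real (triOneArm (8 * a₃)) := mul_le_mul_of_nonneg_left h1 hc'.le
    _ ≤ (triSitePercolation t).real (triOneArm N) := h2

/-! ### The three regimes of the bulk -/

section Regimes

variable {t : unitInterval} {N r₀ rL : ℕ} {c c' cQ cL β : ℝ}

/-- **Inner bulk** (the tree's `pivotal_bound_inner` with quasi-multiplicativity at scales `≤ N`):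
for `|v|_𝕋 = k` with `3430 ≤ k`, `8 max(4r₀+1, r_L) ≤ k`, `k + 1 ≤ 0.32 N`,
`P_t(v pivotal for 0 ↔ ∂Λ_N) ≤ (324 / (c c' c_Q c_L)) (N/k)^{2-β} π̂_t(r₀, N) P_t(0 ↔ ∂Λ_N)`. [cite: WernerPCMI2009, Lecture 6, §5 ("Using differential inequalities for the one-arm event")] -/
theorem pivotal_bound_inner' (hc : 0 < c) (hc' : 0 < c') (hcQ : 0 < cQ) (hcL : 0 < cL)
    (hβ : 0 < β) (hβ2 : β ≤ 2)
    (hq : ∀ a : ℕ, 1000 ≤ a → a ≤ N → ∀ m : ℕ, 3 * a ≤ m → ∀ R : ℝ, 8 * (a : ℝ) ≤ R →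
      ∀ n : ℕ, (n : ℝ) ≤ R →
        c * ((triSitePercolation t).real (triOneArm m) *
          (triSitePercolation t).real (triOpenCrossing (4 * a) R)) ≤
          (triSitePercolation t).real (triOneArm n))
    (hext : ∀ a : ℕ, 1000 ≤ a → a ≤ N → ∀ m n : ℕ, 3 * a ≤ m → n ≤ 8 * a →
      c' * (triSitePercolation t).real (triOneArm m) ≤ (triSitePercolation t).real (triOneArm n))
    (hQ : ∀ R S : ℕ, 16 * r₀ < 4 * R → 4 * R < S → S ≤ N →
      cQ * (fourArmProbAt t r₀ R * fourArmProbAt t (4 * R) S) ≤ fourArmProbAt t r₀ S)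
    (hL : ∀ m n : ℕ, rL ≤ m → m ≤ n → n ≤ N → cL * ((m : ℝ) / n) ^ (2 - β) ≤ fourArmProbAt t m n)
    (hr₀ : 1 ≤ r₀) (hN : 8000 ≤ N) (hNr : 20 * r₀ + 10 ≤ N) (hNL : 5 * rL + 5 ≤ N)
    {v : Site 2} {k : ℕ} (hk : triNorm v = k) (hk1 : 3430 ≤ k) (hk2 : 8 * (4 * r₀ + 1) ≤ k)
    (hk3 : 8 * rL ≤ k) (hkN : k + 1 ≤ 32 * N / 100) :
    (triSitePercolation t).real {ω | IsPivotal (triOneArm N) v ω} ≤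
      324 / (c * c' * cQ * cL) * ((N : ℝ) / k) ^ (2 - β) *
        (fourArmProbAt t r₀ N * (triSitePercolation t).real (triOneArm N)) := by
  set d : ℕ := k / 8 with hd
  set m : ℕ := k - d - 1 with hm
  set m' : ℕ := k + d + 1 with hm'
  have hdr : 4 * r₀ + 1 ≤ d := by omega
  have hdL : rL ≤ d := by omega
  have hdN : d ≤ N := by omega
  have hk0 : (0 : ℝ) < k := by exact_mod_cast (show 0 < k by omega)
  have hN0 : (0 : ℝ) < N := by exact_mod_cast (show 0 < N by omega)
  have hd0 : (0 : ℝ) < d := by exact_mod_cast (show 0 < d by omega)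
  have hexp : (0 : ℝ) ≤ 2 - β := by linarith
  -- the three-event bound
  have h1 := measureReal_isPivotal_triOneArm_le t (N := N) (m := m) (m' := m') hr₀
    (by omega : r₀ ≤ d) hk (by omega) (by omega) (by omega) (by omega) (by omega)
  -- glue inner and outer arm
  have h2 := inner_outer_le' hc hc' hq hext hN hk1 hkN hd (m := m) (m' := m') (by omega) rfl
  -- the local four-arm factor
  have h3 := fourArmProbAt_le_ratio_mul hcQ hcL hβ hβ2 hQ hL hNr hNL hdr hdL hdN
  -- `N/d ≤ 9 N/k`
  have h4 : ((N : ℝ) / d) ^ (2 - β) ≤ 81 * ((N : ℝ) / k) ^ (2 - β) := by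
    have hle : (N : ℝ) / d ≤ 9 * ((N : ℝ) / k) := by
      rw [div_le_iff₀ hd0, mul_div_assoc', div_mul_eq_mul_div, le_div_iff₀ hk0]
      have hdk : (k : ℝ) ≤ 9 * d := by
        have : k ≤ 9 * d := by omega
        exact_mod_cast this
      nlinarith
    calc ((N : ℝ) / d) ^ (2 - β) ≤ (9 * ((N : ℝ) / k)) ^ (2 - β) :=
          Real.rpow_le_rpow (by positivity) hle hexp
      _ = (9 : ℝ) ^ (2 - β) * ((N : ℝ) / k) ^ (2 - β) := Real.mul_rpow (by norm_num) (by positivity)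
      _ ≤ (9 : ℝ) ^ (2 : ℝ) * ((N : ℝ) / k) ^ (2 - β) := by
          apply mul_le_mul_of_nonneg_right _ (by positivity)
          exact Real.rpow_le_rpow_of_exponent_le (by norm_num) (by linarith)
      _ = 81 * ((N : ℝ) / k) ^ (2 - β) := by norm_num
  have hπN : 0 ≤ fourArmProbAt t r₀ N := fourArmProbAt_nonneg t r₀ N
  calc (triSitePercolation t).real {ω | IsPivotal (triOneArm N) v ω}
      ≤ (triSitePercolation t).real (triOneArm m) *
          (fourArmProbAt t r₀ d * (triSitePercolation t).real (armEvent ![true] m' N)) := h1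
    _ = fourArmProbAt t r₀ d * ((triSitePercolation t).real (triOneArm m) *
          (triSitePercolation t).real (armEvent ![true] m' N)) := by ring
    _ ≤ (4 / (cQ * cL) * ((N : ℝ) / d) ^ (2 - β) * fourArmProbAt t r₀ N) *
          (1 / (c * c') * (triSitePercolation t).real (triOneArm N)) :=
        mul_le_mul h3 h2 (mul_nonneg measureReal_nonneg measureReal_nonneg) (by positivity)
    _ ≤ (4 / (cQ * cL) * (81 * ((N : ℝ) / k) ^ (2 - β)) * fourArmProbAt t r₀ N) *
          (1 / (c * c') * (triSitePercolation t).real (triOneArm N)) := by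
        apply mul_le_mul_of_nonneg_right _ (by positivity)
        apply mul_le_mul_of_nonneg_right _ hπN
        exact mul_le_mul_of_nonneg_left h4 (by positivity)
    _ = 324 / (c * c' * cQ * cL) * ((N : ℝ) / k) ^ (2 - β) *
          (fourArmProbAt t r₀ N * (triSitePercolation t).real (triOneArm N)) := by
        field_simp
        ring

/-- **Middle bulk** (the tree's `pivotal_bound_mid` with extendability at scales `≤ N`): for
`0.32 N ≤ k + 1`, `k ≤ 9N/10`,
`P_t(v pivotal) ≤ (1764 / (c'² c_Q c_L)) (N/k)^{2-β} π̂_t(r₀, N) P_t(0 ↔ ∂Λ_N)`. [cite: WernerPCMI2009, Lecture 6, §5 ("Using differential inequalities for the one-arm event")] -/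
theorem pivotal_bound_mid' (hc' : 0 < c') (hcQ : 0 < cQ) (hcL : 0 < cL) (hβ : 0 < β) (hβ2 : β ≤ 2)
    (hext : ∀ a : ℕ, 1000 ≤ a → a ≤ N → ∀ m n : ℕ, 3 * a ≤ m → n ≤ 8 * a →
      c' * (triSitePercolation t).real (triOneArm m) ≤ (triSitePercolation t).real (triOneArm n))
    (hQ : ∀ R S : ℕ, 16 * r₀ < 4 * R → 4 * R < S → S ≤ N →
      cQ * (fourArmProbAt t r₀ R * fourArmProbAt t (4 * R) S) ≤ fourArmProbAt t r₀ S)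
    (hL : ∀ m n : ℕ, rL ≤ m → m ≤ n → n ≤ N → cL * ((m : ℝ) / n) ^ (2 - β) ≤ fourArmProbAt t m n)
    (hr₀ : 1 ≤ r₀) (hN : 12000 ≤ N) (hNr : 20 * (4 * r₀ + 1) ≤ N) (hNL : 20 * rL ≤ N)
    {v : Site 2} {k : ℕ} (hk : triNorm v = k) (hk1 : 32 * N / 100 ≤ k + 1) (hk2 : k ≤ 9 * N / 10) :
    (triSitePercolation t).real {ω | IsPivotal (triOneArm N) v ω} ≤
      1764 / (c' ^ 2 * cQ * cL) * ((N : ℝ) / k) ^ (2 - β) *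
        (fourArmProbAt t r₀ N * (triSitePercolation t).real (triOneArm N)) := by
  set d : ℕ := N / 20 with hd
  set m : ℕ := k - d - 1 with hm
  set m' : ℕ := k + d + 1 with hm'
  have hdr : 4 * r₀ + 1 ≤ d := by omega
  have hdL : rL ≤ d := by omega
  have hdN : d ≤ N := by omega
  have hk0 : (0 : ℝ) < k := by exact_mod_cast (show 0 < k by omega)
  have hN0 : (0 : ℝ) < N := by exact_mod_cast (show 0 < N by omega)
  have hd0 : (0 : ℝ) < d := by exact_mod_cast (show 0 < d by omega)
  have hexp : (0 : ℝ) ≤ 2 - β := by linarith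
  have h1 := measureReal_isPivotal_triOneArm_le t (N := N) (m := m) (m' := m') hr₀
    (by omega : r₀ ≤ d) hk (by omega) (by omega) (by omega) (by omega) (by omega)
  have h2 := extend_twice_le' hc' hext hN (m := m) (by omega) (by omega)
  have h3 := fourArmProbAt_le_ratio_mul hcQ hcL hβ hβ2 hQ hL (by omega) (by omega) hdr hdL hdN
  have hkN' : (1 : ℝ) ≤ (N : ℝ) / k := by
    rw [le_div_iff₀ hk0, one_mul]; exact_mod_cast (show k ≤ N by omega)
  have h4 : ((N : ℝ) / d) ^ (2 - β) ≤ 441 * ((N : ℝ) / k) ^ (2 - β) := by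
    have hle : (N : ℝ) / d ≤ 21 := by
      rw [div_le_iff₀ hd0]
      have : N ≤ 21 * d := by omega
      exact_mod_cast this
    calc ((N : ℝ) / d) ^ (2 - β) ≤ (21 : ℝ) ^ (2 - β) := Real.rpow_le_rpow (by positivity) hle hexp
      _ ≤ (21 : ℝ) ^ (2 : ℝ) := Real.rpow_le_rpow_of_exponent_le (by norm_num) (by linarith)
      _ = 441 * 1 := by norm_num
      _ ≤ 441 * ((N : ℝ) / k) ^ (2 - β) :=
          mul_le_mul_of_nonneg_left (Real.one_le_rpow hkN' hexp) (by norm_num)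
  have hπN : 0 ≤ fourArmProbAt t r₀ N := fourArmProbAt_nonneg t r₀ N
  have hX1 : (triSitePercolation t).real (armEvent ![true] m' N) ≤ 1 := measureReal_le_one
  calc (triSitePercolation t).real {ω | IsPivotal (triOneArm N) v ω}
      ≤ (triSitePercolation t).real (triOneArm m) *
          (fourArmProbAt t r₀ d * (triSitePercolation t).real (armEvent ![true] m' N)) := h1
    _ ≤ (triSitePercolation t).real (triOneArm m) * (fourArmProbAt t r₀ d * 1) := by
        apply mul_le_mul_of_nonneg_left _ measureReal_nonneg
        exact mul_le_mul_of_nonneg_left hX1 (fourArmProbAt_nonneg t r₀ d)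
    _ = fourArmProbAt t r₀ d * (triSitePercolation t).real (triOneArm m) := by ring
    _ ≤ (4 / (cQ * cL) * ((N : ℝ) / d) ^ (2 - β) * fourArmProbAt t r₀ N) *
          (1 / c' ^ 2 * (triSitePercolation t).real (triOneArm N)) :=
        mul_le_mul h3 h2 measureReal_nonneg (by positivity)
    _ ≤ (4 / (cQ * cL) * (441 * ((N : ℝ) / k) ^ (2 - β)) * fourArmProbAt t r₀ N) *
          (1 / c' ^ 2 * (triSitePercolation t).real (triOneArm N)) := by
        apply mul_le_mul_of_nonneg_right _ (by positivity)
        apply mul_le_mul_of_nonneg_right _ hπN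
        exact mul_le_mul_of_nonneg_left h4 (by positivity)
    _ = 1764 / (c' ^ 2 * cQ * cL) * ((N : ℝ) / k) ^ (2 - β) *
          (fourArmProbAt t r₀ N * (triSitePercolation t).real (triOneArm N)) := by
        field_simp
        ring

/-- **Small distances, `t ≥ 1/4`** (the tree's `pivotal_bound_small` for `t ≥ 1/2`): for
`|v|_𝕋 < K`, `K ≥ r₀ ≥ r_L`, `r₀ ≤ N`, the crude bound `P_t(v pivotal) ≤ P_t(0 ↔ ∂Λ_N)/t ≤ 4 P_t(0 ↔ ∂Λ_N)`
(`measureReal_isPivotal_le_div`) and `π̂_t(r₀, N) ≥ c_L (r₀/N)^{2-β}` give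
`P_t(v pivotal) ≤ (4K²/(c_L r₀²)) (N / max(1, |v|))^{2-β} π̂_t(r₀, N) P_t(0 ↔ ∂Λ_N)`. [cite: WernerPCMI2009, Lecture 6, §5 ("Using differential inequalities for the one-arm event")] -/
theorem pivotal_bound_small' (ht : 1 / 4 ≤ (t : ℝ)) (hcL : 0 < cL) (hβ : 0 < β) (hβ2 : β ≤ 2)
    (hL : ∀ m n : ℕ, rL ≤ m → m ≤ n → n ≤ N → cL * ((m : ℝ) / n) ^ (2 - β) ≤ fourArmProbAt t m n)
    {K : ℕ} (hr₀ : 1 ≤ r₀) (hrL : rL ≤ r₀) (hKr : r₀ ≤ K) (hr₀N : r₀ ≤ N) {v : Site 2}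
    (hvK : triNorm v < K) :
    (triSitePercolation t).real {ω | IsPivotal (triOneArm N) v ω} ≤
      4 * (K : ℝ) ^ 2 / (cL * (r₀ : ℝ) ^ 2) * ((N : ℝ) / max 1 (triNorm v : ℝ)) ^ (2 - β) *
        (fourArmProbAt t r₀ N * (triSitePercolation t).real (triOneArm N)) := by
  classical
  have hr0 : (0 : ℝ) < r₀ := by exact_mod_cast (show 0 < r₀ by omega)
  have hK0 : (0 : ℝ) < K := by exact_mod_cast (show 0 < K by omega)
  have hN0 : (0 : ℝ) < N := by exact_mod_cast (show 0 < N by omega)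
  have hexp : (0 : ℝ) ≤ 2 - β := by linarith
  have hmax1 : (1 : ℝ) ≤ max 1 (triNorm v : ℝ) := le_max_left _ _
  have hmax0 : (0 : ℝ) < max 1 (triNorm v : ℝ) := lt_of_lt_of_le one_pos hmax1
  have hmaxK : max 1 (triNorm v : ℝ) ≤ K := by
    apply max_le
    · exact_mod_cast (show 1 ≤ K by omega)
    · exact_mod_cast hvK.le
  -- crude bound `P_t(v pivotal) ≤ P_t(A)/t ≤ 4 P_t(A)`
  have ht0 : 0 < (t : ℝ) := by linarith
  have h1 : (triSitePercolation t).real {ω | IsPivotal (triOneArm N) v ω} ≤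
      4 * (triSitePercolation t).real (triOneArm N) :=
    calc (triSitePercolation t).real {ω | IsPivotal (triOneArm N) v ω}
        ≤ (triSitePercolation t).real (triOneArm N) / t :=
          measureReal_isPivotal_le_div t ht0 (determinedBy_triOneArm N) (isUpperSet_triOneArm N) v
      _ ≤ (triSitePercolation t).real (triOneArm N) / (1 / 4) :=
          div_le_div_of_nonneg_left measureReal_nonneg (by norm_num) ht
      _ = 4 * (triSitePercolation t).real (triOneArm N) := by ring
  -- `1 ≤ (K²/(c_L r₀²)) (N/max)^{2-β} π̂(r₀, N)`
  have h2 := hL r₀ N hrL hr₀N le_rfl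
  have hratio : ((N : ℝ) / K) ^ (2 - β) ≤ ((N : ℝ) / max 1 (triNorm v : ℝ)) ^ (2 - β) :=
    Real.rpow_le_rpow (by positivity) (div_le_div_of_nonneg_left hN0.le hmax0 hmaxK) hexp
  have hprod : cL * ((r₀ : ℝ) / K) ^ (2 : ℝ) ≤
      ((N : ℝ) / max 1 (triNorm v : ℝ)) ^ (2 - β) * fourArmProbAt t r₀ N := by
    have hrK : (r₀ : ℝ) / K ≤ 1 := by rw [div_le_one hK0]; exact_mod_cast hKr
    have hrK0 : (0 : ℝ) < (r₀ : ℝ) / K := div_pos hr0 hK0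
    calc cL * ((r₀ : ℝ) / K) ^ (2 : ℝ) ≤ cL * ((r₀ : ℝ) / K) ^ (2 - β) := by
          apply mul_le_mul_of_nonneg_left _ hcL.le
          exact Real.rpow_le_rpow_of_exponent_ge hrK0 hrK (by linarith)
      _ = ((N : ℝ) / K) ^ (2 - β) * (cL * ((r₀ : ℝ) / N) ^ (2 - β)) := by
          rw [mul_left_comm, ← Real.mul_rpow (by positivity) (by positivity)]
          congr 2
          field_simp
      _ ≤ ((N : ℝ) / max 1 (triNorm v : ℝ)) ^ (2 - β) * fourArmProbAt t r₀ N :=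
          mul_le_mul hratio h2 (by positivity) (by positivity)
  have hsq : ((r₀ : ℝ) / K) ^ (2 : ℝ) = (r₀ : ℝ) ^ 2 / (K : ℝ) ^ 2 := by
    rw [Real.rpow_two, div_pow]
  rw [hsq] at hprod
  have hAN : 0 ≤ (triSitePercolation t).real (triOneArm N) := measureReal_nonneg
  have hkey : (4 : ℝ) ≤ 4 * (K : ℝ) ^ 2 / (cL * (r₀ : ℝ) ^ 2) *
      (((N : ℝ) / max 1 (triNorm v : ℝ)) ^ (2 - β) * fourArmProbAt t r₀ N) := by
    have hcr : 0 < cL * (r₀ : ℝ) ^ 2 := by positivity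
    rw [mul_comm (4 * (K : ℝ) ^ 2 / (cL * (r₀ : ℝ) ^ 2)), ← mul_div_assoc, le_div_iff₀ hcr]
    have := mul_le_mul_of_nonneg_left hprod (show (0 : ℝ) ≤ 4 * (K : ℝ) ^ 2 by positivity)
    have hK2 : (0 : ℝ) < (K : ℝ) ^ 2 := by positivity
    calc 4 * (cL * (r₀ : ℝ) ^ 2) = 4 * (K : ℝ) ^ 2 * (cL * ((r₀ : ℝ) ^ 2 / (K : ℝ) ^ 2)) := by
          field_simp
      _ ≤ 4 * (K : ℝ) ^ 2 * (((N : ℝ) / max 1 (triNorm v : ℝ)) ^ (2 - β) * fourArmProbAt t r₀ N) :=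
          this
      _ = ((N : ℝ) / max 1 (triNorm v : ℝ)) ^ (2 - β) * fourArmProbAt t r₀ N * (4 * (K : ℝ) ^ 2) := by
          ring
  calc (triSitePercolation t).real {ω | IsPivotal (triOneArm N) v ω}
      ≤ 4 * (triSitePercolation t).real (triOneArm N) := h1
    _ ≤ (4 * (K : ℝ) ^ 2 / (cL * (r₀ : ℝ) ^ 2) *
          (((N : ℝ) / max 1 (triNorm v : ℝ)) ^ (2 - β) * fourArmProbAt t r₀ N)) *
          (triSitePercolation t).real (triOneArm N) := mul_le_mul_of_nonneg_right hkey hAN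
    _ = 4 * (K : ℝ) ^ 2 / (cL * (r₀ : ℝ) ^ 2) * ((N : ℝ) / max 1 (triNorm v : ℝ)) ^ (2 - β) *
          (fourArmProbAt t r₀ N * (triSitePercolation t).real (triOneArm N)) := by ring

end Regimes

/-! ### The bulk sum on both sides of `1/2` -/

/-- **The one-arm pivotal sum in the bulk, both sides of `1/2`** (Werner 2009, Lecture 6, §5;
Nolin 2008, §6.2, proof of Thm. 27, Case 1, eqs. (6.6)–(6.9), "uniformly in `P̂` between `P_p` and
`P_{1-p}`"): from Werner's Cor. 6.2 (`Werner2009_fourArm_quasiMult`) and the a priori four-arm lower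
bound (`Werner2009_fourArm_lowerBound`), used two-sidedly by colour exchange, for every small `ε`
and every large inner radius `r₀` there are `n₁`, `δ > 0`, `C` with
`Σ_{v ∈ Λ_{⌊9N/10⌋}} P_t(v pivotal for 0 ↔ ∂Λ_N) ≤ C · N² π̂_t(r₀, N) · P_t(0 ↔ ∂Λ_N)` for all
`t ≠ 1/2` with `|t - 1/2| < δ` and `n₁ ≤ N`, `4N ≤ L_ε(t)` (Nolin's length; on the super-critical
side the tree's `oneArmPivotalSum_bulk_le` needs `N ≤ L(t, ε)` only). [cite: WernerPCMI2009, Lecture 6, §5 ("Using differential inequalities for the one-arm event")] [cite: Nolin2008, §6.2, proof of Thm. 27, Case 1 (arXiv 0711.4948: Thm. 26)] -/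
theorem oneArmPivotalSum_bulk_le_twoSided (hQM : Werner2009_fourArm_quasiMult)
    (hLB : Werner2009_fourArm_lowerBound) :
    ∃ ε₁ > (0 : ℝ), ∀ ⦃ε : ℝ⦄, 0 < ε → ε < ε₁ →
      ∃ r₁ : ℕ, ∀ r₀ ≥ r₁, ∃ n₁ : ℕ, ∃ δ > (0 : ℝ), ∃ C : ℝ,
        ∀ t : unitInterval, |(t : ℝ) - 1 / 2| < δ → (t : ℝ) ≠ 1 / 2 →
          ∀ N : ℕ, n₁ ≤ N → 4 * N ≤ charLength ε t →
            ∑ v ∈ triBall (9 * N / 10), (triSitePercolation t).real {ω | IsPivotal (triOneArm N) v ω} ≤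
              C * ((N : ℝ) ^ 2 * fourArmProbAt t r₀ N) * (triSitePercolation t).real (triOneArm N) := by
  classical
  obtain ⟨εQ, hεQ, HQ⟩ := hQM.two_sided
  obtain ⟨εL, hεL, HL⟩ := hLB.two_sided
  refine ⟨min (min εQ εL) (1 / 2), lt_min (lt_min hεQ hεL) (by norm_num), fun ε hε hε₁ => ?_⟩
  have hεQ' : ε < εQ := hε₁.trans_le ((min_le_left _ _).trans (min_le_left _ _))
  have hεL' : ε < εL := hε₁.trans_le ((min_le_left _ _).trans (min_le_right _ _))
  have hε2 : ε < 1 / 2 := hε₁.trans_le (min_le_right _ _)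
  obtain ⟨c, hc, hq⟩ := triOneArm_quasiMult_nearCritical hε hε2
  obtain ⟨c', hc', hext⟩ := triOneArm_extend_nearCritical hε hε2
  obtain ⟨rQ, δQ, hδQ, cQ, hcQ, hQ⟩ := HQ hε hεQ'
  obtain ⟨rL, δL, hδL, β₀, hβ₀, cL, hcL, hL⟩ := HL hε hεL'
  set β : ℝ := min β₀ 1 with hβdef
  have hβ : 0 < β := lt_min hβ₀ one_pos
  have hβ1 : β ≤ 1 := min_le_right _ _
  have hβ2 : β ≤ 2 := hβ1.trans one_le_two
  have hββ₀ : β ≤ β₀ := min_le_left _ _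
  refine ⟨max (max rQ rL) 1, fun r₀ hr₀ => ?_⟩
  have hrQ : rQ ≤ r₀ := ((le_max_left _ _).trans (le_max_left _ _)).trans hr₀
  have hrL : rL ≤ r₀ := ((le_max_right _ _).trans (le_max_left _ _)).trans hr₀
  have hr1 : 1 ≤ r₀ := (le_max_right _ _).trans hr₀
  obtain ⟨K, hK⟩ : ∃ K : ℕ, K = 8 * (4 * r₀ + 1) + 8 * rL + 3430 := ⟨_, rfl⟩
  -- the constants
  set Cs : ℝ := 4 * (K : ℝ) ^ 2 / (cL * (r₀ : ℝ) ^ 2) with hCs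
  set Ci : ℝ := 324 / (c * c' * cQ * cL) with hCi
  set Cm : ℝ := 1764 / (c' ^ 2 * cQ * cL) with hCm
  set Cstar : ℝ := Cs + Ci + Cm with hCstar
  have hCs0 : 0 < Cs := by
    rw [hCs]; have : (0 : ℝ) < K := by exact_mod_cast (show 0 < K by omega)
    have : (0 : ℝ) < r₀ := by exact_mod_cast (show 0 < r₀ by omega)
    positivity
  have hCi0 : 0 < Ci := by rw [hCi]; positivity
  have hCm0 : 0 < Cm := by rw [hCm]; positivity
  have hCstar0 : 0 < Cstar := by rw [hCstar]; positivity
  refine ⟨max 12000 (20 * (4 * r₀ + 1) + 20 * rL + K), min (min δQ δL) (1 / 4),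
    lt_min (lt_min hδQ hδL) (by norm_num), 24 * (1 + 1 / β) * Cstar,
    fun t htδ htne N hN hNL => ?_⟩
  have hN12 : 12000 ≤ N := (le_max_left _ _).trans hN
  have hN2 : 20 * (4 * r₀ + 1) + 20 * rL + K ≤ N := (le_max_right _ _).trans hN
  have hN0 : (0 : ℝ) < N := by exact_mod_cast (show 0 < N by omega)
  have htQ : |(t : ℝ) - 1 / 2| < δQ := htδ.trans_le ((min_le_left _ _).trans (min_le_left _ _))
  have htL : |(t : ℝ) - 1 / 2| < δL := htδ.trans_le ((min_le_left _ _).trans (min_le_right _ _))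
  have ht14 : 1 / 4 ≤ (t : ℝ) := by
    have h := htδ.trans_le (min_le_right _ _)
    rw [abs_sub_lt_iff] at h
    linarith
  -- `N ≤ L_ε(t) ≤ L(t, ε)`
  have hNLε : N ≤ charLength ε t := le_trans (by omega) hNL
  have hNW : N ≤ charLengthW ε t := hNLε.trans (charLength_le_charLengthW hε htne)
  -- the two facts at `t`, for radii `≤ N`
  have hQt : ∀ R S : ℕ, 16 * r₀ < 4 * R → 4 * R < S → S ≤ N →
      cQ * (fourArmProbAt t r₀ R * fourArmProbAt t (4 * R) S) ≤ fourArmProbAt t r₀ S :=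
    fun R S h1 h2 h3 => hQ t htQ r₀ R S hrQ h1 h2 fun _ => h3.trans hNW
  have hLt : ∀ m n : ℕ, rL ≤ m → m ≤ n → n ≤ N →
      cL * ((m : ℝ) / n) ^ (2 - β) ≤ fourArmProbAt t m n := by
    intro m n h1 h2 h3
    have h := hL t htL m n h1 h2 fun _ => h3.trans hNW
    refine le_trans (mul_le_mul_of_nonneg_left ?_ hcL.le) h
    rcases Nat.eq_zero_or_pos m with hm | hm
    · subst hm
      simp only [CharP.cast_eq_zero, zero_div]
      rw [Real.zero_rpow (ne_of_gt (by linarith))]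
      exact Real.rpow_nonneg le_rfl _
    · have hn : 0 < n := by omega
      apply Real.rpow_le_rpow_of_exponent_ge
      · exact div_pos (by exact_mod_cast hm) (by exact_mod_cast hn)
      · rw [div_le_one (by exact_mod_cast hn)]; exact_mod_cast h2
      · linarith
  -- quasi-multiplicativity and extendability at `t`, for scales `a ≤ N` (`2a, 4a ≤ 4N ≤ L_ε(t)`)
  have hqt : ∀ a : ℕ, 1000 ≤ a → a ≤ N → ∀ m : ℕ, 3 * a ≤ m → ∀ R : ℝ, 8 * (a : ℝ) ≤ R →
      ∀ n : ℕ, (n : ℝ) ≤ R →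
        c * ((triSitePercolation t).real (triOneArm m) *
          (triSitePercolation t).real (triOpenCrossing (4 * a) R)) ≤
          (triSitePercolation t).real (triOneArm n) :=
    fun a ha haN m hm R hR n hn => hq t a ha (fun _ => by omega) m hm R hR n hn
  have hextt : ∀ a : ℕ, 1000 ≤ a → a ≤ N → ∀ m n : ℕ, 3 * a ≤ m → n ≤ 8 * a →
      c' * (triSitePercolation t).real (triOneArm m) ≤ (triSitePercolation t).real (triOneArm n) :=
    fun a ha haN m n hm hn => hext t a ha (fun _ => by omega) m n hm hn
  have hKr : r₀ ≤ K := by omega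
  have hKN : K ≤ N := by omega
  have hr₀N : r₀ ≤ N := hKr.trans hKN
  set Q : ℝ := fourArmProbAt t r₀ N * (triSitePercolation t).real (triOneArm N) with hQdef
  have hQ0 : 0 ≤ Q := mul_nonneg (fourArmProbAt_nonneg t r₀ N) measureReal_nonneg
  -- the uniform bound for each site of the bulk
  have hunif : ∀ v ∈ triBall (9 * N / 10),
      (triSitePercolation t).real {ω | IsPivotal (triOneArm N) v ω} ≤
        Cstar * ((N : ℝ) / max 1 (triNorm v : ℝ)) ^ (2 - β) * Q := by
    intro v hv
    rw [mem_triBall_iff] at hv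
    obtain ⟨k, hk⟩ : ∃ k : ℕ, triNorm v = k := ⟨(triNorm v).toNat, by have := triNorm_nonneg v; omega⟩
    have hkM : k ≤ 9 * N / 10 := by omega
    have hpow0 : 0 ≤ ((N : ℝ) / max 1 (triNorm v : ℝ)) ^ (2 - β) := by positivity
    by_cases hsmall : k < K
    · have hvK : triNorm v < K := by rw [hk]; exact_mod_cast hsmall
      have h := pivotal_bound_small' ht14 hcL hβ hβ2 hLt hr1 hrL hKr hr₀N hvK
      refine h.trans ?_
      apply mul_le_mul_of_nonneg_right _ hQ0
      apply mul_le_mul_of_nonneg_right _ hpow0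
      rw [hCstar]; linarith
    · push Not at hsmall
      have hk1 : (1 : ℝ) ≤ k := by exact_mod_cast (show 1 ≤ k by omega)
      have hmax : max 1 (triNorm v : ℝ) = k := by
        rw [hk]; push_cast; exact max_eq_right hk1
      rw [hmax]
      by_cases hin : k + 1 ≤ 32 * N / 100
      · have h := pivotal_bound_inner' hc hc' hcQ hcL hβ hβ2 hqt hextt hQt hLt hr1 (by omega)
          (by omega) (by omega) hk (by omega) (by omega) (by omega) hin
        refine h.trans ?_
        apply mul_le_mul_of_nonneg_right _ hQ0
        apply mul_le_mul_of_nonneg_right _ (by positivity)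
        rw [hCstar]; linarith
      · push Not at hin
        have h := pivotal_bound_mid' hc' hcQ hcL hβ hβ2 hextt hQt hLt hr1 hN12 (by omega) (by omega) hk
          (by omega) hkM
        refine h.trans ?_
        apply mul_le_mul_of_nonneg_right _ hQ0
        apply mul_le_mul_of_nonneg_right _ (by positivity)
        rw [hCstar]; linarith
  -- summing the shells
  set M : ℕ := 9 * N / 10 with hM
  have hM1 : 1 ≤ M := by omega
  have hMN : M ≤ N := by omega
  set g : Site 2 → ℝ := fun v => ((N : ℝ) / max 1 (triNorm v : ℝ)) ^ (2 - β) with hg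
  have hshell : ∀ k : ℕ, ∑ v ∈ triSphere k, g v ≤
      (12 * (k : ℝ) + 6) * ((N : ℝ) ^ (2 - β) * (max (1 : ℝ) k) ^ (β - 2)) := by
    intro k
    have hconst : ∀ v ∈ triSphere k, g v = (N : ℝ) ^ (2 - β) * (max (1 : ℝ) k) ^ (β - 2) := by
      intro v hv
      rw [mem_triSphere_iff] at hv
      rw [hg]
      simp only [hv, Int.cast_natCast]
      exact div_rpow_two_sub hN0.le (lt_of_lt_of_le one_pos (le_max_left _ _))
    rw [Finset.sum_congr rfl hconst, Finset.sum_const, nsmul_eq_mul]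
    apply mul_le_mul_of_nonneg_right _ (by positivity)
    exact_mod_cast card_triSphere_le k
  have hsumg : ∑ v ∈ triBall M, g v ≤ 24 * (1 + 1 / β) * (N : ℝ) ^ 2 := by
    rw [sum_triBall_eq_sum_triSphere g M]
    calc ∑ k ∈ Finset.range (M + 1), ∑ v ∈ triSphere k, g v
        ≤ ∑ k ∈ Finset.range (M + 1), (12 * (k : ℝ) + 6) * ((N : ℝ) ^ (2 - β) * (max (1 : ℝ) k) ^ (β - 2)) :=
          Finset.sum_le_sum fun k _ => hshell k
      _ = (N : ℝ) ^ (2 - β) * ∑ k ∈ Finset.range (M + 1), (12 * (k : ℝ) + 6) * (max (1 : ℝ) k) ^ (β - 2) := by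
          rw [Finset.mul_sum]; refine Finset.sum_congr rfl fun k _ => ?_; ring
      _ ≤ (N : ℝ) ^ (2 - β) * (24 * (1 + 1 / β) * (M : ℝ) ^ β) :=
          mul_le_mul_of_nonneg_left (sum_shell_weight_le hβ hβ1 hM1) (by positivity)
      _ ≤ (N : ℝ) ^ (2 - β) * (24 * (1 + 1 / β) * (N : ℝ) ^ β) := by
          apply mul_le_mul_of_nonneg_left _ (by positivity)
          apply mul_le_mul_of_nonneg_left _ (by positivity)
          exact Real.rpow_le_rpow (by positivity) (by exact_mod_cast hMN) hβ.le
      _ = 24 * (1 + 1 / β) * ((N : ℝ) ^ (2 - β) * (N : ℝ) ^ β) := by ring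
      _ = 24 * (1 + 1 / β) * (N : ℝ) ^ 2 := by
          rw [← Real.rpow_add hN0, sub_add_cancel, Real.rpow_two]
  calc ∑ v ∈ triBall M, (triSitePercolation t).real {ω | IsPivotal (triOneArm N) v ω}
      ≤ ∑ v ∈ triBall M, Cstar * g v * Q := Finset.sum_le_sum hunif
    _ = Cstar * Q * ∑ v ∈ triBall M, g v := by
        rw [Finset.mul_sum]; refine Finset.sum_congr rfl fun v _ => ?_; ring
    _ ≤ Cstar * Q * (24 * (1 + 1 / β) * (N : ℝ) ^ 2) :=
        mul_le_mul_of_nonneg_left hsumg (mul_nonneg hCstar0.le hQ0)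
    _ = 24 * (1 + 1 / β) * Cstar * ((N : ℝ) ^ 2 * fourArmProbAt t r₀ N) *
          (triSitePercolation t).real (triOneArm N) := by rw [hQdef]; ring

end Literature.Probability.Percolation
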